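import Mathlib
import HarnessLib
import Literature.Analysis.FluidPDE.VectorCalculus

/-!
# Route `UnthreadedDoor` / `ThreadingFlux`, crux `PoloidalLiouville` (stmt-NavierStokesRegularity-1222), antidynamo v2 skeleton
# (sha16 `4ebf5683127b`), rung `stub_singleDegreeRung` (BC5): THE POLYNOMIAL PROFILE — bridging the rung's `MvPolynomial` datum to the
# function-level hypotheses of step S2 (`…AntidynamoVorticityStructure.exists_analytic_coeff_curl_eq`)

Support file (seat leafhand-ns-unthreadeddoor-1 g0, cell decomp-ns), `--supports stmt-NavierStokesRegularity-1222 --as helper`; theorems only.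
The rung quantifies over `P : MvPolynomial (Fin 3) ℝ`, homogeneous of degree `l`, evaluated as `Q y = eval (fun i => y i) P`.  Step S2 asks
of `Q`: real-analyticity, positive homogeneity, and the ray invariance of the non-vanishing of `Λ = ∇Q × id`.  These three are supplied here
(the remaining two — `Q` nowhere locally constant on the unit sphere and `Λ ≠ 0` densely — need HARMONICITY and are left as the next brick):

* `contDiff_omega_evalPoly` — `y ↦ eval (fun i => y i) P` is `C^ω` on `ℝ³`.
* `evalPoly_smul` — `Q (r • y) = r ^ l * Q y` for a homogeneous `P` of degree `l` (all real `r`).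
* `gradient_smul_of_homogeneous` — for a differentiable positively homogeneous function of degree `l`, `∇Q(r y) = r^l r⁻¹ • ∇Q(y)` (`r > 0`),
  hence `cross_gradient_smul_of_homogeneous : Λ(r y) = r ^ l • Λ(y)` and `cross_gradient_ne_zero_smul : Λ y ≠ 0 → Λ (r y) ≠ 0`.

HONEST LABEL: elementary; nothing here bears on `PoloidalLiouville` (1222) or NS regularity.  [folklore]
-/

noncomputable section

-- the summit and its single sub-problem share the name (CONVENTIONS §1)
set_option linter.dupNamespace false

open scoped Topology InnerProductSpace RealInnerProductSpace ContDiff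
open Filter Set Function Metric MvPolynomial
open Literature.Analysis.FluidPDE

namespace Summit.NavierStokesRegularity.NavierStokesRegularity.Theorems.PoloidalLiouville.Antidynamo

/-- Polynomial functions on `ℝ³` are real-analytic (`C^ω`). [folklore] -/
theorem contDiff_omega_evalPoly (p : MvPolynomial (Fin 3) ℝ) :
    ContDiff ℝ ω fun y : EuclideanSpace ℝ (Fin 3) => eval (fun i => y i) p := by
  induction p using MvPolynomial.induction_on with
  | C a => simpa using (contDiff_const : ContDiff ℝ ω fun _ : EuclideanSpace ℝ (Fin 3) => a)
  | add p q hp hq => simpa using hp.add hq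
  | mul_X p i hp =>
    have hX : ContDiff ℝ ω fun y : EuclideanSpace ℝ (Fin 3) => y i :=
      (EuclideanSpace.proj i : EuclideanSpace ℝ (Fin 3) →L[ℝ] ℝ).contDiff
    simpa using hp.mul hX

/-- A homogeneous polynomial of degree `l` is a positively (indeed fully) homogeneous function: `Q (r • y) = r ^ l * Q y`. [folklore] -/
theorem evalPoly_smul {p : MvPolynomial (Fin 3) ℝ} {l : ℕ} (hp : p.IsHomogeneous l) (r : ℝ) (y : EuclideanSpace ℝ (Fin 3)) :
    eval (fun i => (r • y) i) p = r ^ l * eval (fun i => y i) p := by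
  rw [eval_eq', eval_eq', Finset.mul_sum]
  refine Finset.sum_congr rfl fun α hα => ?_
  have hdeg : ∑ i, α i = l := by
    have h := hp (mem_support_iff.1 hα)
    rw [Finsupp.weight_apply, Finsupp.sum_fintype _ _ (by simp)] at h
    simpa using h
  simp_rw [PiLp.smul_apply, smul_eq_mul, mul_pow, Finset.prod_mul_distrib, Finset.prod_pow_eq_pow_sum, hdeg]
  ring

/-- The gradient of a differentiable positively homogeneous function of degree `l` scales like `r ^ l / r` along rays. [folklore] -/
theorem gradient_smul_of_homogeneous {Q : EuclideanSpace ℝ (Fin 3) → ℝ} (hQ : Differentiable ℝ Q) {l : ℕ}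
    (hhom : ∀ r : ℝ, 0 < r → ∀ y : EuclideanSpace ℝ (Fin 3), Q (r • y) = r ^ l * Q y)
    {r : ℝ} (hr : 0 < r) (y : EuclideanSpace ℝ (Fin 3)) :
    gradient Q (r • y) = (r ^ l * r⁻¹) • gradient Q y := by
  -- two derivatives of `y ↦ Q (r • y)`
  have hs : HasFDerivAt (fun z : EuclideanSpace ℝ (Fin 3) => r • z)
      (r • ContinuousLinearMap.id ℝ (EuclideanSpace ℝ (Fin 3))) y := (hasFDerivAt_id y).const_smul r
  have h1 : HasFDerivAt (fun z : EuclideanSpace ℝ (Fin 3) => Q (r • z))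
      ((fderiv ℝ Q (r • y)).comp (r • ContinuousLinearMap.id ℝ (EuclideanSpace ℝ (Fin 3)))) y :=
    (hQ (r • y)).hasFDerivAt.comp y hs
  have h2 : HasFDerivAt (fun z : EuclideanSpace ℝ (Fin 3) => Q (r • z)) (r ^ l • fderiv ℝ Q y) y := by
    have : (fun z : EuclideanSpace ℝ (Fin 3) => Q (r • z)) = fun z => r ^ l * Q z := funext (hhom r hr)
    rw [this]
    exact (hQ y).hasFDerivAt.const_mul (r ^ l)
  have h12 := h1.unique h2
  have key : ∀ w : EuclideanSpace ℝ (Fin 3), fderiv ℝ Q (r • y) w = (r ^ l * r⁻¹) * fderiv ℝ Q y w := by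
    intro w
    have hw := congrArg (fun L : EuclideanSpace ℝ (Fin 3) →L[ℝ] ℝ => L w) h12
    simp only [ContinuousLinearMap.coe_comp, comp_apply, _root_.smul_apply, ContinuousLinearMap.coe_id', id_eq,
      map_smul, smul_eq_mul] at hw
    -- `hw : r * DQ(ry) w = r ^ l * DQ(y) w`
    have hr0 : r ≠ 0 := hr.ne'
    field_simp
    linear_combination hw
  rw [gradient, gradient]
  apply (InnerProductSpace.toDual ℝ (EuclideanSpace ℝ (Fin 3))).injective
  rw [LinearIsometryEquiv.apply_symm_apply]
  ext w
  rw [key w, InnerProductSpace.toDual_apply_apply, real_inner_smul_left, InnerProductSpace.toDual_symm_apply]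

/-- The toroidal field `Λ = ∇Q × id` of a positively homogeneous `Q` of degree `l` scales by `r ^ l` along rays. [folklore] -/
theorem cross_gradient_smul_of_homogeneous {Q : EuclideanSpace ℝ (Fin 3) → ℝ} (hQ : Differentiable ℝ Q) {l : ℕ}
    (hhom : ∀ r : ℝ, 0 < r → ∀ y : EuclideanSpace ℝ (Fin 3), Q (r • y) = r ^ l * Q y)
    {r : ℝ} (hr : 0 < r) (y : EuclideanSpace ℝ (Fin 3)) :
    cross (gradient Q (r • y)) (r • y) = r ^ l • cross (gradient Q y) y := by
  rw [gradient_smul_of_homogeneous hQ hhom hr y, ← crossCLM_apply, map_smul, map_smul, _root_.smul_apply, crossCLM_apply,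
    smul_smul]
  congr 1
  field_simp

/-- Non-vanishing of `Λ = ∇Q × id` is invariant along rays (positively homogeneous `Q`). [folklore] -/
theorem cross_gradient_ne_zero_smul {Q : EuclideanSpace ℝ (Fin 3) → ℝ} (hQ : Differentiable ℝ Q) {l : ℕ}
    (hhom : ∀ r : ℝ, 0 < r → ∀ y : EuclideanSpace ℝ (Fin 3), Q (r • y) = r ^ l * Q y)
    {y : EuclideanSpace ℝ (Fin 3)} (hy : cross (gradient Q y) y ≠ 0) {r : ℝ} (hr : 0 < r) :
    cross (gradient Q (r • y)) (r • y) ≠ 0 := by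
  rw [cross_gradient_smul_of_homogeneous hQ hhom hr y]
  exact smul_ne_zero (pow_ne_zero l hr.ne') hy

end Summit.NavierStokesRegularity.NavierStokesRegularity.Theorems.PoloidalLiouville.Antidynamo

end
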